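import Summits.ValiantsHypothesis.ValiantsHypothesis.Theorems.KPlusLogSqLawTropicalShiftSquareDefs

/-!
# Route «KPlusLogSqLaw» — the explicit `K = 2A + 2` tropical family SHIFT-LADDER: definitions

HONEST FRAMING.  Definitions-only file (D-0009) of a helper chain `--supports` the crux
`Summit.ValiantsHypothesis.ValiantsHypothesis.Theses.KPlusLogSqLaw.TropicalB` (ledger item `stmt-ValiantsHypothesis-19771`, route
`KPlusLogSqLaw`; object-search cell `pub-symmetroid`, seat val-sym-trop-p5 g8, 2026-08-27).  It names ONE explicit tropical design per format
`(m, 2A+2)`, `m = n + 1 ≥ 1`, `A ≥ 0`, in the tree's dominance vocabulary (`tropWeight`, `termSign`, `IsDominant`), the grid of its intended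
optima and the bookkeeping functions of the proof; nothing is proved here (the companion files `…TropicalShiftLadder.lean` /
`…TropicalShiftLadderChain.lean` prove that the design has `(m+1)(A·m+1)` sign-alternating unique optima, whence
`TropicalCensus.TropRootLawAt m (2A+2) B → (A·m+1)(m+1) − 1 ≤ B`, and that this MEETS the rank-two GAP ceiling
`KPlusLogSqLaw.Sumset.chain_succ_le_of_gap` for exponents `{a₁ + a₂·D : a₁ ≤ A, a₂ ≤ 1}`).  These are concrete witnesses, not notions: no
statement of the route depends on them.  Nothing here asserts `TropicalB`, `WeakLifting`, `KPlusLogSqLaw`, `MatrixDescartes` or anything about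
`VP ≠ VNP`; the family is quadratic in `m` (slope `A` in the class count), far inside every open question of the cell.

THE DESIGN (SHIFT-SQUARE `…TropicalShiftSquareDefs.lean` = the case `A = 1`; SHIFT-THREE's rotation skeleton).  Classes `l < 2A + 2` are read
as a LOW RUNG `lo l = l mod (A+1) ∈ [0, A]` and a HIGH BIT `hi l = l div (A+1) ∈ {0, 1}`; exponents `d l = lo l + hi l · D` (`dd`) with
`D = m·κ`, `κ = 2A·W + 1`, `W = A·m + 1` (`bigD`, `kap`, `width`) — a rank-two generalized arithmetic progression with digit bounds `(A, 1)`.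
Entry `(a, b)` has shift `q = a − b (mod m)` (`ShiftThree.shiftZ`) and wraps iff `a < b`; presence (`ee`): wrapping entries carry the `A + 1`
HIGH classes, entries below the diagonal the `A + 1` LOW classes, the diagonal all `2A + 2`; the EFFECTIVE shift (`eshift`) of a diagonal high
incidence is `m` (in the gauge `θ·κ·shift − θ·D·[wrap]` it scores `θ·D = θ·κ·m`).  Valuations (`vv`): `pen q = κ·W·q(q+1)` at the effective shift
plus the cumulative price `priceSum q b j = Σ_{i ≤ j} (2W·q + 2((i−1)m + b + 1))` of the first `j = lo l` rungs.  Signs (`lsign`): `(−1)^{lo l}`,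
times the global constant `hsign = (−1)^{(A+1)m}` on the high classes (this makes the phase boundaries alternate for every parity of `A` and `m`;
it is `1` when `A = 1`).  Grid: phase `p ≤ m` (`σ_p = ρ^p`, `ShiftSquare.rot`; phase `m` = the identity at the high level), step `a ≤ A·m`, slope
`θ(p,a) = 2W·p + 2a + 1` (`th`); the class map `lam p a` puts the high bit on the columns with `b + p ≥ m` and the low rung `lvl a b =
a div m + [b < a mod m]` (`lvl`; the rungs are climbed round-robin, column `b`'s `i`-th rung at `θ = 2W·p + 2((i−1)m + b + 1)`); `cterm`, `phi`
(per-incidence score in the gauge), `gval θ q = θκq − pen q`, `bonus θ q b j = j·θ − priceSum q b j`, `grid k = (k div W, k mod W)`.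
-/

set_option linter.dupNamespace false
set_option autoImplicit false

namespace Summit.ValiantsHypothesis.ValiantsHypothesis.Theorems.LacunarySymmetroidMatrixDescartes.TropicalCensus

open Summit.ValiantsHypothesis.ValiantsHypothesis.Theorems.MatrixDescartes.Negative
open scoped BigOperators
open Finset

namespace ShiftLadder

open ShiftThree (shiftZ)
open ShiftSquare (rot)

variable (A n : ℕ)

/-- the phase width `W = A·m + 1` (number of grid points per phase). -/
def width : ℕ := A * (n + 1) + 1

/-- the gauge slope `κ = 2A·W + 1` per unit of shift. -/
def kap : ℕ := 2 * A * width A n + 1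

/-- the large exponent `D = m·κ` of the high bit. -/
def bigD : ℕ := (n + 1) * kap A n

/-- low level `l mod (A+1)` of a class. -/
def lo (l : Fin (2 * A + 2)) : ℕ := (l : ℕ) % (A + 1)

/-- high bit `l div (A+1)` of a class (`0` or `1`). -/
def hi (l : Fin (2 * A + 2)) : ℕ := (l : ℕ) / (A + 1)

/-- exponents `d l = lo l + hi l · D`: the rank-two progression `{j + h·D : j ≤ A, h ≤ 1}`. -/
def dd (l : Fin (2 * A + 2)) : ℕ := lo A l + hi A l * bigD A n

/-- effective shift of an incidence: the entry's shift, except that a high class on the diagonal counts as shift `m`. -/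
def eshift (a b : Fin (n + 1)) (l : Fin (2 * A + 2)) : ℤ :=
  if (a : ℕ) = (b : ℕ) ∧ hi A l = 1 then ((n : ℤ) + 1) else shiftZ n a b

/-- shift penalty `pen q = κ·W·q(q+1)`. -/
def pen (q : ℤ) : ℤ := (kap A n : ℤ) * (width A n : ℤ) * (q * (q + 1))

/-- cumulative price of the first `j` low rungs on an entry of column `b` with effective shift `q`:
`Σ_{i ≤ j} (2W·q + 2((i−1)m + b + 1)) = j(2W q + 2(b+1)) + m·j(j−1)`. -/
def priceSum (q : ℤ) (b : Fin (n + 1)) (j : ℕ) : ℤ :=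
  (j : ℤ) * (2 * (width A n : ℤ) * q + 2 * ((b : ℤ) + 1)) + ((n : ℤ) + 1) * j * ((j : ℤ) - 1)

/-- valuations: penalty of the effective shift plus the cumulative price of the low rungs. -/
def vv : Fin (n + 1) → Fin (n + 1) → Fin (2 * A + 2) → ℤ := fun a b l =>
  pen A n (eshift A n a b l) + priceSum A n (eshift A n a b l) b (lo A l)

/-- the global sign carried by every high incidence: `(−1)^{(A+1)m}` (makes the carries alternate for all parities of `A`, `m`). -/
def hsign : ℤ := (-1) ^ ((A + 1) * (n + 1))

/-- sign of a class: `(−1)^{lo l}`, times `hsign` for a high class. -/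
def lsign (l : Fin (2 * A + 2)) : ℤ := (-1) ^ lo A l * (if hi A l = 1 then hsign A n else 1)

/-- presence/sign pattern: wrapping entries carry the high classes, entries below the diagonal the low classes, the diagonal all. -/
def ee : Fin (n + 1) → Fin (n + 1) → Fin (2 * A + 2) → ℤ := fun a b l =>
  if (a : ℕ) < (b : ℕ) then (if hi A l = 1 then lsign A n l else 0)
  else if (a : ℕ) = (b : ℕ) then lsign A n l
  else (if hi A l = 1 then 0 else lsign A n l)

/-- slope grid: `θ(p,a) = 2W·p + 2a + 1`. -/
def th (p a : ℕ) : ℤ := 2 * (width A n : ℤ) * p + 2 * a + 1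

/-- the low level of column `b` at step `a`: `a div m` full rounds plus one if `b < a mod m`. -/
def lvl (a : ℕ) (b : Fin (n + 1)) : ℕ := a / (n + 1) + (if (b : ℕ) < a % (n + 1) then 1 else 0)

/-- the class map of the grid point `(p, a)`: high bit on the columns with `b + p ≥ m`, low level `lvl a b` (capped at `A`). -/
def lam (p a : ℕ) : Fin (n + 1) → Fin (2 * A + 2) := fun b =>
  ⟨min A (lvl n a b) + (A + 1) * (if n + 1 ≤ (b : ℕ) + p then 1 else 0), by
    have h1 : min A (lvl n a b) ≤ A := min_le_left _ _
    split_ifs <;> omega⟩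

/-- the Leibniz term of the grid point `(p, a)`. -/
def cterm (p a : ℕ) : Equiv.Perm (Fin (n + 1)) × (Fin (n + 1) → Fin (2 * A + 2)) := (rot n p, lam A n p a)

/-- per-incidence score in the zero-sum gauge `θ·κ·shift − θ·D·[wrap]`. -/
def phi (θ : ℤ) (a b : Fin (n + 1)) (l : Fin (2 * A + 2)) : ℤ :=
  θ * (dd A n l : ℤ) - vv A n a b l + θ * (kap A n : ℤ) * shiftZ n a b -
    θ * (bigD A n : ℤ) * (if (a : ℕ) < (b : ℕ) then 1 else 0)

/-- shift part of the score: `g_θ(q) = θκq − pen q`. -/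
def gval (θ q : ℤ) : ℤ := θ * (kap A n : ℤ) * q - pen A n q

/-- the `k`-th grid point `(k div W, k mod W)`. -/
def grid (k : ℕ) : ℕ × ℕ := (k / width A n, k % width A n)

/-- the low-rung bonus `j·θ − priceSum`. -/
def bonus (θ q : ℤ) (b : Fin (n + 1)) (j : ℕ) : ℤ := (j : ℤ) * θ - priceSum A n q b j

end ShiftLadder

end Summit.ValiantsHypothesis.ValiantsHypothesis.Theorems.LacunarySymmetroidMatrixDescartes.TropicalCensus
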